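import Literature.Probability.RandomPlanarGeometry.SAWPolygonUnrooting
import Mathlib.Data.List.GetD
import HarnessLib

/-!
# A kernel census of the first square-lattice counts: `c_n(ℤ²)` for `n ≤ 9` and `q_N(ℤ²)` for `N ≤ 14`
# (Madras–Slade, Appendix C, Tables C.1 and C.3 — first entries, kernel-checked)

Topic `Literature/Probability/RandomPlanarGeometry` (lane «pcv-sawmu», a-p4 g17; companion of `HexSAWPolygonCensus.lean` (same seat,
same method on the honeycomb lattice); sits on `SAWCount.lean` — `Zd.saws d n`, `Zd.count d n = c_n`, `Zd.card_saws : #saws d n = c_n` —,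
`SAWPolygonConcatenation.lean` — `Zd.PolygonConcat.canonLoops d N` (`Q[N]`, both orientations), `polygonNumber d N = q_N`,
`card_canonLoops : #canonLoops d N = 2 q_N` (`N ≥ 3`) — and `SAWPolygonUnrooting.lean` (`Zd.PolygonConcat.mem_saLoops_iff`)).

Source of the printed numbers: N. Madras, G. Slade, *The Self-Avoiding Walk* (Birkhäuser 1993), Appendix C «Tables of exact enumerations»,
**Table C.1** (p. 394) «The number of self-avoiding walks for d = 2, 3», column `d = 2`, AS PRINTED:
`n = 0, 1, …, 9 : 1, 4, 12, 36, 100, 284, 780, 2172, 5916, 16268`; and **Table C.3** (p. 396) «The number of self-avoiding polygons for d = 2, 3»,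
column `d = 2`: `n = 4, 6, 8, 10, 12, 14 : 1, 2, 7, 28, 124, 588` [MadrasSlade1993]. Also §1.1 p. 2 (`c_1 = 2d`, `c_2 = 2d(2d−1)`, …).

## Method (no new idea; a certified finite enumeration — see `HexSAWPolygonCensus.lean` for the honeycomb twin)

`Census2.prefixesRev loop n k` enumerates, as REVERSED lists of integer pairs, the `k`-step `ℤ²` self-avoiding walks from `(0,0)`; in loop mode
(`loop = true`) only those whose sites are lexicographically `≥ 0` and within `ℓ¹`-distance `n − k` of the origin (a prefix that strays farther
cannot close up at time `n`).  `walksRev n` (all `n`-step walks) and `loopsRev N` (prefixes of length `N − 1` ending next to the origin = the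
canonical loops `Q[N]` read at times `0, …, N−1`) are then finite lists, duplicate-free by construction (`nodup_prefixesRev`), and
**`Census2.count_two_eq_length_walksRev : c_n(ℤ²) = #walksRev n`** (every `n`) and
**`Census2.two_mul_polygonNumber_two_eq : 2 q_N(ℤ²) = #loopsRev N`** (`N ≥ 3`) hold by two injections each way (completeness: `revList`,
with the distance pruning justified by `dist_le_of_adj_of_eq_zero`; soundness: the well-formedness predicate `WF` and the walk/loop
`funOf` / `loopOf` of a list).  The numbers are `decide +kernel` evaluations (kernel reduction only — no `native_decide`, no `ofReduceBool`;
the largest, `c_9` and `q_14`, take about a minute each on the farm and carry `maxHeartbeats 400000`).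

## Results (namespace `Literature.Probability.RandomPlanarGeometry.SAW.Zd`)

* `Census2.count_two_eq_length_walksRev`, `Census2.card_canonLoops_two_eq`, `Census2.two_mul_polygonNumber_two_eq` (structural, all `n`/`N`);
* **`count_two_le_nine : c_1, …, c_9 (ℤ²) = 4, 12, 36, 100, 284, 780, 2172, 5916, 16268`** (Table C.1);
* **`polygonNumber_two_le_fourteen : q_4, q_6, …, q_14 (ℤ²) = 1, 2, 7, 28, 124, 588`** (Table C.3);
* `count_two_four_lt : c_4(ℤ²) < 4·3³` (the first excess of the trivial bound `c_n ≤ 2d(2d−1)^{n−1}`, p. 2).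

NOT claimed: anything beyond `n = 9` / `N = 14`; other dimensions.  Label (lane): DATA-LEMMA / kernel census recovering PRINTED tables.
-/

set_option maxRecDepth 4000

open Finset Function Literature.Probability.LatticeModels SimpleGraph

namespace Literature.Probability.RandomPlanarGeometry.SAW

namespace Zd

namespace Census2

/-! ### Computable enumeration on `ℤ × ℤ` -/

/-- The four `ℤ²` neighbours of an integer site. [cite: MadrasSlade1993, §1.1 (nearest neighbours of ℤ^d)] -/
def nbrs (p : ℤ × ℤ) : List (ℤ × ℤ) := [(p.1 + 1, p.2), (p.1 - 1, p.2), (p.1, p.2 + 1), (p.1, p.2 - 1)]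

/-- Lexicographic nonnegativity, as a `Bool`. [cite: MadrasSlade1993, §3.2 (proof of Theorem 3.2.3: `Q[N]`)] -/
def lexNN (p : ℤ × ℤ) : Bool := decide (0 < p.1 ∨ (p.1 = 0 ∧ 0 ≤ p.2))

/-- Admissibility of a next site with `r` steps to go (pruning predicate `P`): fresh, `P`, within `ℓ¹`-distance `r` of the origin
when `close = true`. [cite: MadrasSlade1993, §1.1] -/
def admissible (loop : Bool) (r : ℕ) (l : List (ℤ × ℤ)) (q : ℤ × ℤ) : Bool :=
  decide (q ∉ l) && (!loop || (lexNN q && decide (q.1.natAbs + q.2.natAbs ≤ r)))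

/-- One-step extensions of a reversed site list. [cite: MadrasSlade1993, §1.1] -/
def extendRev (loop : Bool) (r : ℕ) : List (ℤ × ℤ) → List (List (ℤ × ℤ))
  | [] => []
  | p :: t => ((nbrs p).filter (admissible loop r (p :: t))).map fun q => q :: p :: t

/-- Reversed `k`-step prefixes: all self-avoiding walks (`loop = false`), or the pruned prefixes of canonical `n`-loops (`loop = true`).
[cite: MadrasSlade1993, §1.1 (c_n) and §3.2 (Q[N])] -/
def prefixesRev (loop : Bool) (n : ℕ) : ℕ → List (List (ℤ × ℤ))
  | 0 => [[(0, 0)]]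
  | k + 1 => (prefixesRev loop n k).flatMap (extendRev loop (n - (k + 1)))

/-- The `n`-step self-avoiding walks of `ℤ²` from the origin, as reversed site lists. [cite: MadrasSlade1993, §1.1 (c_n)] -/
def walksRev (n : ℕ) : List (List (ℤ × ℤ)) := prefixesRev false n n

/-- The canonical `N`-step loops (`Q[N]`, both orientations) as reversed lists of their sites at times `0, …, N−1`: the last site is a
neighbour of the origin. [cite: MadrasSlade1993, §3.2 (proof of Theorem 3.2.3: `Q[N]`)] -/
def loopsRev (N : ℕ) : List (List (ℤ × ℤ)) :=
  (prefixesRev true N (N - 1)).filter fun l => decide (∃ q ∈ l.head?, q.1.natAbs + q.2.natAbs = 1)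

/-! ### Dictionary with `Site 2` -/

/-- Integer pair to site. [cite: MadrasSlade1993, §1.1 (sites of ℤ^d)] -/
def toSite (p : ℤ × ℤ) : Site 2 := ![p.1, p.2]

/-- Site to integer pair. [cite: MadrasSlade1993, §1.1 (sites of ℤ^d)] -/
def ofSite (z : Site 2) : ℤ × ℤ := (z 0, z 1)

/-- Coordinates of `toSite`. [cite: MadrasSlade1993, §1.1 (sites of ℤ^d)] -/
@[simp] private theorem toSite_apply_zero (p : ℤ × ℤ) : toSite p 0 = p.1 := rfl

/-- Coordinates of `toSite`. [cite: MadrasSlade1993, §1.1 (sites of ℤ^d)] -/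
@[simp] private theorem toSite_apply_one (p : ℤ × ℤ) : toSite p 1 = p.2 := rfl

/-- `toSite ∘ ofSite = id`. [cite: MadrasSlade1993, §1.1 (sites of ℤ^d)] -/
@[simp] private theorem toSite_ofSite (z : Site 2) : toSite (ofSite z) = z := by
  funext i; fin_cases i <;> rfl

/-- `ofSite ∘ toSite = id`. [cite: MadrasSlade1993, §1.1 (sites of ℤ^d)] -/
@[simp] private theorem ofSite_toSite (p : ℤ × ℤ) : ofSite (toSite p) = p := by
  cases p; rfl

/-- `toSite` is injective. [cite: MadrasSlade1993, §1.1 (sites of ℤ^d)] -/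
private theorem toSite_injective : Function.Injective toSite := fun p q h => by
  simpa using congrArg ofSite h

/-- `toSite (0,0) = 0`. [cite: MadrasSlade1993, §1.1 (sites of ℤ^d)] -/
private theorem toSite_zero : toSite (0, 0) = (0 : Site 2) := by
  funext i; fin_cases i <;> rfl

/-- `ofSite 0 = (0,0)`. [cite: MadrasSlade1993, §1.1 (sites of ℤ^d)] -/
@[simp] private theorem ofSite_zero : ofSite (0 : Site 2) = (0, 0) := rfl

/-- `ℤ²` adjacency in coordinates (private re-derivation; the tree's `SAWTiles.adj_iff_coord` / `zdGraph_two_adj_iff_coord` are the public forms).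
[cite: MadrasSlade1993, §1.1 (nearest neighbours of ℤ^d)] -/
private theorem zd2_adj_iff (x y : Site 2) : (zdGraph 2).Adj x y ↔
    ((y 0 = x 0 + 1 ∨ x 0 = y 0 + 1) ∧ y 1 = x 1) ∨ ((y 1 = x 1 + 1 ∨ x 1 = y 1 + 1) ∧ y 0 = x 0) := by
  rw [zdGraph_adj_iff, Fin.exists_fin_two]
  simp only [funext_iff, Fin.forall_fin_two, Pi.add_apply, Pi.single_eq_same,
    Pi.single_eq_of_ne (one_ne_zero : (1 : Fin 2) ≠ 0),
    Pi.single_eq_of_ne (zero_ne_one : (0 : Fin 2) ≠ 1), add_zero]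
  omega

/-- `nbrs` is the `ℤ²` adjacency. [cite: MadrasSlade1993, §1.1 (nearest neighbours of ℤ^d)] -/
theorem mem_nbrs_iff {p q : ℤ × ℤ} : q ∈ nbrs p ↔ (zdGraph 2).Adj (toSite p) (toSite q) := by
  obtain ⟨a, b⟩ := p; obtain ⟨c, d⟩ := q
  rw [zd2_adj_iff]
  simp only [toSite_apply_zero, toSite_apply_one, nbrs, List.mem_cons, List.mem_nil_iff, or_false, Prod.mk.injEq]
  omega

/-- `toLex x < toLex y` on `ℤ²` in coordinates. [cite: MadrasSlade1993, §3.2 (proof of Theorem 3.2.3: lexicographic order)] -/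
private theorem toLex_lt_iff_coord_c2 {x y : Site 2} : toLex x < toLex y ↔ x 0 < y 0 ∨ (x 0 = y 0 ∧ x 1 < y 1) := by
  constructor
  · rintro ⟨i, hi, hlt⟩
    fin_cases i
    · exact Or.inl hlt
    · exact Or.inr ⟨hi 0 (by decide), hlt⟩
  · rintro (h | ⟨h0, h1⟩)
    · exact ⟨0, fun j hj => absurd hj (by simp), h⟩
    · refine ⟨1, fun j hj => ?_, h1⟩
      have : j = 0 := by
        rcases Fin.eq_zero_or_eq_succ j with rfl | ⟨k, rfl⟩
        · rfl
        · exfalso; fin_cases k; simp at hj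
      subst this; exact h0

/-- `toLex 0 ≤ toLex z` on `ℤ²` in coordinates. [cite: MadrasSlade1993, §3.2 (proof of Theorem 3.2.3: lexicographic order)] -/
private theorem toLex_nonneg_iff_c2 {z : Site 2} : toLex (0 : Site 2) ≤ toLex z ↔ 0 < z 0 ∨ (z 0 = 0 ∧ 0 ≤ z 1) := by
  rw [le_iff_lt_or_eq, toLex_lt_iff_coord_c2, EmbeddingLike.apply_eq_iff_eq]
  simp only [Pi.zero_apply]
  constructor
  · rintro ((h | ⟨h0, h1⟩) | h)
    · exact Or.inl h
    · exact Or.inr ⟨h0.symm, h1.le⟩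
    · subst h; exact Or.inr ⟨rfl, le_rfl⟩
  · rintro (h | ⟨h0, h1⟩)
    · exact Or.inl (Or.inl h)
    · rcases h1.lt_or_eq with h1 | h1
      · exact Or.inl (Or.inr ⟨h0.symm, h1⟩)
      · right; funext i; fin_cases i
        · exact h0.symm
        · exact h1

/-- `lexNN (ofSite z) ↔ 0 ≤ₗ z`. [cite: MadrasSlade1993, §3.2 (proof of Theorem 3.2.3: `Q[N]`)] -/
theorem lexNN_ofSite_iff (z : Site 2) : lexNN (ofSite z) = true ↔ toLex (0 : Site 2) ≤ toLex z := by
  rw [toLex_nonneg_iff_c2]; simp [lexNN, ofSite]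

/-! ### The reversed site list of a walk -/

/-- `revList ω k = [site k, …, site 0]` as integer pairs. [cite: MadrasSlade1993, §1.1] -/
def revList (ω : ℕ → Site 2) : ℕ → List (ℤ × ℤ)
  | 0 => [ofSite (ω 0)]
  | k + 1 => ofSite (ω (k + 1)) :: revList ω k

/-- `revList ω k` has length `k + 1`. [cite: MadrasSlade1993, §1.1] -/
private theorem length_revList (ω : ℕ → Site 2) (k : ℕ) : (revList ω k).length = k + 1 := by
  induction k with
  | zero => rfl
  | succ k ih => simp [revList, ih]

/-- The head of `revList ω k` is site `k`. [cite: MadrasSlade1993, §1.1] -/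
private theorem head?_revList (ω : ℕ → Site 2) (k : ℕ) : (revList ω k).head? = some (ofSite (ω k)) := by
  cases k <;> rfl

/-- Membership in `revList ω k`. [cite: MadrasSlade1993, §1.1] -/
private theorem mem_revList {ω : ℕ → Site 2} {k : ℕ} {q : ℤ × ℤ} : q ∈ revList ω k ↔ ∃ i, i ≤ k ∧ q = ofSite (ω i) := by
  induction k with
  | zero => simp [revList]
  | succ k ih =>
    simp only [revList, List.mem_cons, ih]
    constructor
    · rintro (rfl | ⟨i, hi, rfl⟩)
      · exact ⟨k + 1, le_rfl, rfl⟩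
      · exact ⟨i, by omega, rfl⟩
    · rintro ⟨i, hi, rfl⟩
      rcases Nat.lt_or_ge i (k + 1) with h | h
      · exact Or.inr ⟨i, by omega, rfl⟩
      · left; rw [show i = k + 1 by omega]

/-- The `j`-th entry of `revList ω k` is site `k − j`. [cite: MadrasSlade1993, §1.1] -/
private theorem getElem_revList (ω : ℕ → Site 2) (k : ℕ) {j : ℕ} (hj : j < (revList ω k).length) :
    (revList ω k)[j] = ofSite (ω (k - j)) := by
  induction k generalizing j with
  | zero =>
    simp only [revList, List.length_cons, List.length_nil, zero_add, Nat.lt_one_iff] at hj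
    subst hj; rfl
  | succ k ih =>
    cases j with
    | zero => rfl
    | succ j =>
      simp only [revList, List.getElem_cons_succ]
      rw [ih]
      congr 2; omega

/-- `revList · k` determines the sites up to time `k`. [cite: MadrasSlade1993, §1.1] -/
private theorem eq_of_revList_eq {ω ω' : ℕ → Site 2} {k : ℕ} (h : revList ω k = revList ω' k) {i : ℕ} (hi : i ≤ k) : ω i = ω' i := by
  have hlen := length_revList ω k
  have h1 := getElem_revList ω k (j := k - i) (by rw [hlen]; omega)
  have h2 := getElem_revList ω' k (j := k - i) (by rw [length_revList]; omega)
  have e : (revList ω k)[k - i]'(by rw [hlen]; omega) = (revList ω' k)[k - i]'(by rw [length_revList]; omega) := by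
    simp only [h]
  rw [h1, h2, show k - (k - i) = i by omega] at e
  simpa using congrArg toSite e

/-! ### Completeness -/

/-- Along a `ℤ²` walk that is at the origin at time `n`, the site at time `i ≤ n` is within `ℓ¹`-distance `n − i` of the origin.
[cite: MadrasSlade1993, §1.1] -/
theorem dist_le_of_adj_of_eq_zero {n : ℕ} {ω : ℕ → Site 2} (hadj : ∀ i < n, (zdGraph 2).Adj (ω i) (ω (i + 1))) (hn : ω n = 0)
    {i : ℕ} (hi : i ≤ n) : (ω i 0).natAbs + (ω i 1).natAbs ≤ n - i := by
  obtain ⟨j, rfl⟩ : ∃ j, i = n - j := ⟨n - i, by omega⟩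
  have key : ∀ j, j ≤ n → (ω (n - j) 0).natAbs + (ω (n - j) 1).natAbs ≤ j := by
    intro j
    induction j with
    | zero => intro _; simp [hn]
    | succ j ih =>
      intro hj
      have h := hadj (n - (j + 1)) (by omega)
      rw [show n - (j + 1) + 1 = n - j by omega, zd2_adj_iff] at h
      have := ih (by omega)
      omega
  by_cases hj : j ≤ n
  · simpa [show n - (n - j) = j by omega] using key j hj
  · have := key n le_rfl
    rw [show n - n = 0 by omega] at this
    rw [show n - j = 0 by omega]
    simpa using this.trans (by omega)

/-- One step of completeness: if `revList ω k` is enumerated and step `k` is admissible, `revList ω (k+1)` is enumerated.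
[cite: MadrasSlade1993, §1.1] -/
theorem revList_succ_mem {loop : Bool} {n k : ℕ} {ω : ℕ → Site 2} (hk : revList ω k ∈ prefixesRev loop n k)
    (hadm : admissible loop (n - (k + 1)) (revList ω k) (ofSite (ω (k + 1))) = true)
    (hadj : (zdGraph 2).Adj (ω k) (ω (k + 1))) : revList ω (k + 1) ∈ prefixesRev loop n (k + 1) := by
  simp only [prefixesRev, List.mem_flatMap]
  refine ⟨revList ω k, hk, ?_⟩
  obtain ⟨t, ht⟩ : ∃ t, revList ω k = ofSite (ω k) :: t := by cases k <;> exact ⟨_, rfl⟩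
  rw [revList, ht, extendRev, List.mem_map]
  refine ⟨ofSite (ω (k + 1)), ?_, rfl⟩
  rw [List.mem_filter, ← ht]
  exact ⟨by rw [mem_nbrs_iff, toSite_ofSite, toSite_ofSite]; exact hadj, hadm⟩

/-- **Completeness for walks**: the reversed site list of an `n`-step self-avoiding walk is enumerated. [cite: MadrasSlade1993, §1.1 (c_n)] -/
theorem revList_mem_walksRev {n : ℕ} {ω : ℕ → Site 2} (hω : ω ∈ saws 2 n) : revList ω n ∈ walksRev n := by
  obtain ⟨h0, -, hadj, hinj⟩ := mem_saws.1 hω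
  suffices h : ∀ k, k ≤ n → revList ω k ∈ prefixesRev false n k from h n le_rfl
  intro k
  induction k with
  | zero => intro _; simp [prefixesRev, revList, h0]
  | succ k ih =>
    intro hk
    refine revList_succ_mem (ih (by omega)) ?_ (hadj k (by omega))
    simp only [admissible, Bool.not_false, Bool.true_or, Bool.and_true, decide_eq_true_eq]
    intro hq
    obtain ⟨i, hi, hiq⟩ := mem_revList.1 hq
    have heq : ω (k + 1) = ω i := by simpa using congrArg toSite hiq
    have := hinj (show k + 1 ∈ {i | i ≤ n} by simpa using hk) (show i ∈ {i | i ≤ n} by simp; omega) heq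
    omega

/-- Membership in `canonLoops`, unfolded. [cite: MadrasSlade1993, §3.2 (proof of Theorem 3.2.3: `Q[N]`)] -/
private theorem mem_canonLoops_c2 {N : ℕ} {ω : ℕ → Site 2} :
    ω ∈ PolygonConcat.canonLoops 2 N ↔ ω ∈ saLoops 2 N ∧ ∀ i < N, toLex (0 : Site 2) ≤ toLex (ω i) := by
  classical
  rw [PolygonConcat.canonLoops, Finset.mem_filter]

/-- **Completeness for loops**: the reversed list of the sites at times `0, …, N−1` of a canonical loop is enumerated.
[cite: MadrasSlade1993, §3.2 (proof of Theorem 3.2.3: `Q[N]`)] -/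
theorem revList_mem_loopsRev {N : ℕ} {ω : ℕ → Site 2} (hω : ω ∈ PolygonConcat.canonLoops 2 N) (hN : 1 ≤ N) :
    revList ω (N - 1) ∈ loopsRev N := by
  obtain ⟨hs, hlex⟩ := mem_canonLoops_c2.1 hω
  obtain ⟨h0, -, hadj, hNz, hinj⟩ := PolygonConcat.mem_saLoops_iff.1 hs
  have hpre : ∀ k, k ≤ N - 1 → revList ω k ∈ prefixesRev true N k := by
    intro k
    induction k with
    | zero => intro _; simp [prefixesRev, revList, h0]
    | succ k ih =>
      intro hk
      refine revList_succ_mem (ih (by omega)) ?_ (hadj k (by omega))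
      simp only [admissible, Bool.not_true, Bool.false_or, Bool.and_eq_true, decide_eq_true_eq]
      refine ⟨fun hq => ?_, (lexNN_ofSite_iff _).2 (hlex (k + 1) (by omega)), ?_⟩
      · obtain ⟨i, hi, hiq⟩ := mem_revList.1 hq
        have heq : ω (k + 1) = ω i := by simpa using congrArg toSite hiq
        have := hinj (show k + 1 ∈ {i | i < N} by simp; omega) (show i ∈ {i | i < N} by simp; omega) heq
        omega
      · simpa [ofSite] using dist_le_of_adj_of_eq_zero hadj hNz (i := k + 1) (by omega)
  rw [loopsRev, List.mem_filter]
  refine ⟨hpre _ le_rfl, ?_⟩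
  rw [decide_eq_true_eq, head?_revList]
  refine ⟨ofSite (ω (N - 1)), rfl, ?_⟩
  have h := hadj (N - 1) (by omega)
  rw [show N - 1 + 1 = N by omega, hNz, zd2_adj_iff] at h
  simp only [ofSite, Pi.zero_apply] at h ⊢
  omega

/-! ### Soundness -/

/-- Well-formed reversed site lists for the mode `loop`: start `(0,0)`, `ℤ²` steps, fresh sites, and (loops) sites lexicographically `≥ 0`.
[cite: MadrasSlade1993, §1.1 and §3.2] -/
def WF (loop : Bool) : List (ℤ × ℤ) → Prop
  | [] => False
  | [p] => p = (0, 0)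
  | q :: p :: t => WF loop (p :: t) ∧ q ∈ nbrs p ∧ q ∉ p :: t ∧ (loop = true → lexNN q = true)

/-- Enumerated lists are well formed and have the right length. [cite: MadrasSlade1993, §1.1] -/
theorem wf_of_mem_prefixesRev {loop : Bool} {n k : ℕ} {l : List (ℤ × ℤ)} (hl : l ∈ prefixesRev loop n k) :
    WF loop l ∧ l.length = k + 1 := by
  induction k generalizing l with
  | zero =>
    simp only [prefixesRev, List.mem_singleton] at hl
    subst hl; exact ⟨rfl, rfl⟩
  | succ k ih =>
    simp only [prefixesRev, List.mem_flatMap] at hl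
    obtain ⟨l', hl', hll⟩ := hl
    obtain ⟨hwf, hlen⟩ := ih hl'
    match l', hwf, hlen, hll with
    | p :: t, hwf, hlen, hll =>
      simp only [extendRev, List.mem_map, List.mem_filter] at hll
      obtain ⟨q, ⟨hq, hadm⟩, rfl⟩ := hll
      simp only [admissible, Bool.and_eq_true, decide_eq_true_eq] at hadm
      refine ⟨⟨hwf, hq, hadm.1, fun hloop => ?_⟩, by simpa using hlen⟩
      have h2 := hadm.2
      rw [hloop] at h2
      simp only [Bool.not_true, Bool.false_or, Bool.and_eq_true, decide_eq_true_eq] at h2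
      exact h2.1

/-- A well-formed list is duplicate-free. [cite: MadrasSlade1993, §1.1] -/
theorem WF.nodup {loop : Bool} : ∀ {l : List (ℤ × ℤ)}, WF loop l → l.Nodup
  | [], h => h.elim
  | [p], _ => List.nodup_singleton p
  | _ :: _ :: _, h => List.nodup_cons.2 ⟨h.2.2.1, WF.nodup h.1⟩

/-- The last entry of a well-formed list is `(0,0)`. [cite: MadrasSlade1993, §1.1] -/
theorem WF.getLast_eq {loop : Bool} : ∀ {l : List (ℤ × ℤ)} (_ : WF loop l) (hne : l ≠ []), l.getLast hne = (0, 0)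
  | [], h, _ => h.elim
  | [p], h, _ => by simpa [WF] using h
  | q :: p :: t, h, _ => by
    rw [List.getLast_cons (by simp)]
    exact WF.getLast_eq h.1 (by simp)

/-- In loop mode all entries are lexicographically `≥ 0`. [cite: MadrasSlade1993, §3.2 (proof of Theorem 3.2.3: `Q[N]`)] -/
theorem WF.lexNN_of_mem : ∀ {l : List (ℤ × ℤ)}, WF true l → ∀ q ∈ l, lexNN q = true
  | [], h, _, _ => h.elim
  | [p], h, q, hq => by
    simp only [WF] at h; simp only [List.mem_singleton] at hq; subst hq; subst h; decide
  | q :: p :: t, h, r, hr => by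
    rcases List.mem_cons.1 hr with rfl | hr
    · exact h.2.2.2 rfl
    · exact WF.lexNN_of_mem h.1 r hr

/-- Consecutive entries of a well-formed list are `ℤ²` neighbours. [cite: MadrasSlade1993, §1.1] -/
theorem WF.getElem_mem_nbrs {loop : Bool} : ∀ {l : List (ℤ × ℤ)} (_ : WF loop l) {j : ℕ} (hj : j + 1 < l.length),
    l[j] ∈ nbrs (l[j + 1])
  | [], h, _, _ => h.elim
  | [p], _, j, hj => by simp at hj
  | q :: p :: t, h, 0, _ => by simpa using h.2.1
  | q :: p :: t, h, j + 1, hj => by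
    have := WF.getElem_mem_nbrs h.1 (j := j) (by simpa using hj)
    simpa using this

/-- The walk of a reversed site list of length `n + 1` (frozen after time `n`). [cite: MadrasSlade1993, §1.1] -/
def funOf (n : ℕ) (l : List (ℤ × ℤ)) : ℕ → Site 2 := fun i => toSite (l.getD (n - min i n) (0, 0))

/-- Values of `funOf n l` up to time `n`. [cite: MadrasSlade1993, §1.1] -/
private theorem funOf_apply {n : ℕ} {l : List (ℤ × ℤ)} (hl : l.length = n + 1) {i : ℕ} (hi : i ≤ n) :
    funOf n l i = toSite (l[n - i]'(by rw [hl]; omega)) := by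
  simp only [funOf, min_eq_left hi]
  rw [List.getD_eq_getElem]

/-- The common part of soundness: start, steps and self-avoidance of `funOf n l` for a well-formed `l` of length `n + 1`.
[cite: MadrasSlade1993, §1.1] -/
theorem funOf_props {loop : Bool} {n : ℕ} {l : List (ℤ × ℤ)} (hwf : WF loop l) (hlen : l.length = n + 1) :
    funOf n l 0 = 0 ∧ (∀ i, n ≤ i → funOf n l i = funOf n l n) ∧
      (∀ i < n, (zdGraph 2).Adj (funOf n l i) (funOf n l (i + 1))) ∧ Set.InjOn (funOf n l) {i | i ≤ n} := by
  have hne : l ≠ [] := by rintro rfl; simp at hlen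
  have hget : ∀ {i : ℕ} (hi : i ≤ n), funOf n l i = toSite (l[n - i]'(by rw [hlen]; omega)) := fun hi => funOf_apply hlen hi
  refine ⟨?_, ?_, ?_, ?_⟩
  · rw [hget (Nat.zero_le n)]
    have h1 : l[n - 0]'(by rw [hlen]; omega) = l.getLast hne := by
      rw [List.getLast_eq_getElem]; congr 1; omega
    rw [h1, WF.getLast_eq hwf hne, toSite_zero]
  · intro i hi
    simp only [funOf, min_eq_right hi, min_self]
  · intro i hi
    rw [hget hi.le, hget (by omega : i + 1 ≤ n), ← mem_nbrs_iff]
    have := WF.getElem_mem_nbrs hwf (j := n - (i + 1)) (by rw [hlen]; omega)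
    simpa [show n - (i + 1) + 1 = n - i by omega] using this
  · intro i hi j hj hij
    simp only [Set.mem_setOf_eq] at hi hj
    rw [hget hi, hget hj] at hij
    have e := toSite_injective hij
    have := (List.Nodup.getElem_inj_iff (WF.nodup hwf)).1 e
    omega

/-- **Soundness for walks**: an enumerated full list is an `n`-step self-avoiding walk. [cite: MadrasSlade1993, §1.1 (c_n)] -/
theorem funOf_mem_saws {n : ℕ} {l : List (ℤ × ℤ)} (hl : l ∈ walksRev n) : funOf n l ∈ saws 2 n := by
  obtain ⟨hwf, hlen⟩ := wf_of_mem_prefixesRev hl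
  exact mem_saws.2 (funOf_props hwf hlen)

/-- `funOf n` is injective on lists of length `n + 1`. [cite: MadrasSlade1993, §1.1] -/
theorem funOf_inj {n : ℕ} {l l' : List (ℤ × ℤ)} (hlen : l.length = n + 1) (hlen' : l'.length = n + 1)
    (h : funOf n l = funOf n l') : l = l' := by
  refine List.ext_getElem (by rw [hlen, hlen']) fun j hj hj' => ?_
  have e := congrFun h (n - j)
  rw [funOf_apply hlen (by omega), funOf_apply hlen' (by omega)] at e
  have e' := toSite_injective e
  have hj2 : n - (n - j) = j := by rw [hlen] at hj; omega
  simpa [hj2] using e'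

/-- The loop of a reversed site list `[site N−1, …, site 0]`: back at the origin from time `N` on. [cite: MadrasSlade1993, §3.2] -/
def loopOf (N : ℕ) (l : List (ℤ × ℤ)) : ℕ → Site 2 := fun i => if i < N then funOf (N - 1) l i else 0

/-- **Soundness for loops**: an enumerated full list is a canonical `N`-loop (`N ≥ 2`). [cite: MadrasSlade1993, §3.2 (proof of Theorem 3.2.3: `Q[N]`)] -/
theorem loopOf_mem_canonLoops {N : ℕ} {l : List (ℤ × ℤ)} (hl : l ∈ loopsRev N) (hN : 2 ≤ N) :
    loopOf N l ∈ PolygonConcat.canonLoops 2 N := by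
  rw [loopsRev, List.mem_filter, decide_eq_true_eq] at hl
  obtain ⟨hmem, q, hq, hq1⟩ := hl
  obtain ⟨hwf, hlen⟩ := wf_of_mem_prefixesRev hmem
  obtain ⟨h0, -, hadj, hinj⟩ := funOf_props hwf hlen
  have hval : ∀ {i : ℕ}, i < N → loopOf N l i = funOf (N - 1) l i := fun hi => by rw [loopOf, if_pos hi]
  have hlast : funOf (N - 1) l (N - 1) = toSite q := by
    rw [funOf_apply hlen le_rfl]
    have := List.head?_eq_getElem? (l := l)
    rw [hq, List.getElem?_eq_getElem (by rw [hlen]; omega)] at this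
    simp only [Nat.sub_self]
    rw [show l[0] = q from (Option.some.inj this).symm]
  refine mem_canonLoops_c2.2 ⟨PolygonConcat.mem_saLoops_iff.2 ⟨?_, ?_, ?_, ?_, ?_⟩, ?_⟩
  · rw [hval (by omega), h0]
  · intro i hi; rw [loopOf, loopOf, if_neg (by omega), if_neg (lt_irrefl N)]
  · intro i hi
    by_cases h : i + 1 < N
    · rw [hval hi, hval h]; exact hadj i (by omega)
    · have hi' : i = N - 1 := by omega
      subst hi'
      rw [hval hi, hlast, show N - 1 + 1 = N by omega]
      simp only [loopOf, lt_irrefl, if_false]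
      rw [zd2_adj_iff]
      simp only [toSite_apply_zero, toSite_apply_one, Pi.zero_apply]
      omega
  · rw [loopOf, if_neg (lt_irrefl N)]
  · intro i hi j hj hij
    simp only [Set.mem_setOf_eq] at hi hj
    rw [hval hi, hval hj] at hij
    exact hinj (show i ∈ {i | i ≤ N - 1} by simp; omega) (show j ∈ {i | i ≤ N - 1} by simp; omega) hij
  · intro i hi
    rw [hval hi, funOf_apply hlen (by omega), ← lexNN_ofSite_iff, ofSite_toSite]
    exact WF.lexNN_of_mem hwf _ (List.getElem_mem _)

/-- `loopOf N` is injective on lists of length `N` (`N ≥ 1`). [cite: MadrasSlade1993, §3.2] -/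
theorem loopOf_inj {N : ℕ} {l l' : List (ℤ × ℤ)} (hN : 1 ≤ N) (hlen : l.length = N - 1 + 1) (hlen' : l'.length = N - 1 + 1)
    (h : loopOf N l = loopOf N l') : l = l' := by
  refine funOf_inj hlen hlen' (funext fun i => ?_)
  by_cases hi : i < N
  · have := congrFun h i; simpa [loopOf, hi] using this
  · have e := congrFun h (N - 1)
    simp only [loopOf, show N - 1 < N by omega, if_true] at e
    simp only [funOf, min_eq_right (show N - 1 ≤ i by omega)]
    simpa [funOf] using e

/-! ### The enumeration has no duplicates -/

/-- `nbrs p` has no duplicates. [cite: MadrasSlade1993, §1.1] -/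
theorem nodup_nbrs (p : ℤ × ℤ) : (nbrs p).Nodup := by
  obtain ⟨a, b⟩ := p
  simp [nbrs, Prod.mk.injEq]; omega

/-- The enumeration lists are duplicate-free. [cite: MadrasSlade1993, §1.1] -/
theorem nodup_prefixesRev (loop : Bool) (n k : ℕ) : (prefixesRev loop n k).Nodup := by
  induction k with
  | zero => exact List.nodup_singleton _
  | succ k ih =>
    simp only [prefixesRev]
    rw [List.nodup_flatMap]
    refine ⟨fun l _ => ?_, ?_⟩
    · cases l with
      | nil => exact List.nodup_nil
      | cons p t =>
        simp only [extendRev]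
        exact ((nodup_nbrs p).filter _).map fun q q' h => by simpa using h
    · refine ih.imp_of_mem ?_
      intro a b ha hb hab
      show List.Disjoint (extendRev loop (n - (k + 1)) a) (extendRev loop (n - (k + 1)) b)
      intro x hx hx'
      cases a with
      | nil => simp [extendRev] at hx
      | cons p t =>
        cases b with
        | nil => simp [extendRev] at hx'
        | cons p' t' =>
          simp only [extendRev, List.mem_map, List.mem_filter] at hx hx'
          obtain ⟨q, -, rfl⟩ := hx
          obtain ⟨q', -, hqq⟩ := hx'
          exact hab (by simpa using (List.cons.inj hqq).2.symm)

/-! ### The censuses are exact -/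

/-- **`c_n(ℤ²) = #walksRev n`** for every `n`. [cite: MadrasSlade1993, §1.1 (c_n)] -/
theorem count_two_eq_length_walksRev (n : ℕ) : count 2 n = (walksRev n).length := by
  have hnd : (walksRev n).Nodup := nodup_prefixesRev false n n
  rw [← card_saws, ← List.toFinset_card_of_nodup hnd]
  refine le_antisymm ?_ ?_
  · exact Finset.card_le_card_of_injOn (fun ω => revList ω n) (fun _ hω => List.mem_toFinset.2 (revList_mem_walksRev hω))
      fun ω hω ω' hω' h => by
        obtain ⟨-, hend, -, -⟩ := mem_saws.1 (Finset.mem_coe.1 hω)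
        obtain ⟨-, hend', -, -⟩ := mem_saws.1 (Finset.mem_coe.1 hω')
        funext i
        rcases le_or_gt i n with hi | hi
        · exact eq_of_revList_eq h hi
        · rw [hend i hi.le, hend' i hi.le, eq_of_revList_eq h le_rfl]
  · exact Finset.card_le_card_of_injOn (funOf n) (fun _ hl => funOf_mem_saws (List.mem_toFinset.1 hl))
      fun l hl l' hl' h =>
        funOf_inj (wf_of_mem_prefixesRev (List.mem_toFinset.1 (Finset.mem_coe.1 hl))).2
          (wf_of_mem_prefixesRev (List.mem_toFinset.1 (Finset.mem_coe.1 hl'))).2 h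

/-- **`#Q[N] = #loopsRev N`** (both orientations), `N ≥ 2`. [cite: MadrasSlade1993, §3.2 (proof of Theorem 3.2.3: `Q[N]`)] -/
theorem card_canonLoops_two_eq (N : ℕ) (hN : 2 ≤ N) : #(PolygonConcat.canonLoops 2 N) = (loopsRev N).length := by
  have hnd : (loopsRev N).Nodup := (nodup_prefixesRev true N (N - 1)).filter _
  rw [← List.toFinset_card_of_nodup hnd]
  refine le_antisymm ?_ ?_
  · exact Finset.card_le_card_of_injOn (fun ω => revList ω (N - 1))
      (fun _ hω => List.mem_toFinset.2 (revList_mem_loopsRev hω (by omega)))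
      fun ω hω ω' hω' h => by
        obtain ⟨-, hend, -, hNz, -⟩ := PolygonConcat.mem_saLoops_iff.1 (mem_canonLoops_c2.1 (Finset.mem_coe.1 hω)).1
        obtain ⟨-, hend', -, hNz', -⟩ := PolygonConcat.mem_saLoops_iff.1 (mem_canonLoops_c2.1 (Finset.mem_coe.1 hω')).1
        funext i
        rcases Nat.lt_or_ge i N with hi | hi
        · exact eq_of_revList_eq h (by omega)
        · rw [hend i hi, hend' i hi, hNz, hNz']
  · refine Finset.card_le_card_of_injOn (loopOf N) (fun _ hl => loopOf_mem_canonLoops (List.mem_toFinset.1 hl) hN)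
      fun l hl l' hl' h => ?_
    have h1 := (wf_of_mem_prefixesRev (List.mem_filter.1 (List.mem_toFinset.1 (Finset.mem_coe.1 hl))).1).2
    have h2 := (wf_of_mem_prefixesRev (List.mem_filter.1 (List.mem_toFinset.1 (Finset.mem_coe.1 hl'))).1).2
    exact loopOf_inj (by omega) h1 h2 h

/-- **`2 q_N(ℤ²) = #loopsRev N`**, `N ≥ 3`. [cite: MadrasSlade1993, Definition 3.2.2 and Theorem 3.2.3 (proof: `Q[N]` has `q_N` members)] -/
theorem two_mul_polygonNumber_two_eq (N : ℕ) (hN : 3 ≤ N) : 2 * PolygonConcat.polygonNumber 2 N = (loopsRev N).length := by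
  rw [← PolygonConcat.card_canonLoops hN, card_canonLoops_two_eq N (by omega)]

/-! ### Kernel evaluations -/

/-- `#walksRev n` for `n ≤ 9`: `4, 12, 36, 100, 284, 780, 2172, 5916, 16268`. [cite: MadrasSlade1993, Appendix C Table C.1 (d = 2, n ≤ 9), p. 394] -/
theorem length_walksRev_le_nine :
    (walksRev 1).length = 4 ∧ (walksRev 2).length = 12 ∧ (walksRev 3).length = 36 ∧ (walksRev 4).length = 100 ∧
    (walksRev 5).length = 284 ∧ (walksRev 6).length = 780 ∧ (walksRev 7).length = 2172 ∧ (walksRev 8).length = 5916 := by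
  refine ⟨?_, ?_, ?_, ?_, ?_, ?_, ?_, ?_⟩ <;> decide +kernel

set_option maxHeartbeats 400000 in
/-- `#walksRev 9 = 16268` (the largest walk census of this file). [cite: MadrasSlade1993, Appendix C Table C.1 (d = 2, n = 9), p. 394] -/
theorem length_walksRev_nine : (walksRev 9).length = 16268 := by decide +kernel

/-- `#loopsRev N` for `N = 4, 6, 8, 10, 12`: `2, 4, 14, 56, 248` (both orientations of each polygon). [cite: MadrasSlade1993, Appendix C Table C.3 (d = 2), p. 396] -/
theorem length_loopsRev_le_twelve :
    (loopsRev 4).length = 2 ∧ (loopsRev 6).length = 4 ∧ (loopsRev 8).length = 14 ∧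
    (loopsRev 10).length = 56 ∧ (loopsRev 12).length = 248 := by
  refine ⟨?_, ?_, ?_, ?_, ?_⟩ <;> decide +kernel

set_option maxHeartbeats 400000 in
/-- `#loopsRev 14 = 1176` (the largest loop census of this file). [cite: MadrasSlade1993, Appendix C Table C.3 (d = 2, n = 14), p. 396] -/
theorem length_loopsRev_fourteen : (loopsRev 14).length = 1176 := by decide +kernel

end Census2

/-! ### Madras–Slade Table C.1 / C.3, first entries, kernel-checked -/

/-- **`c_n(ℤ²)` for `n ≤ 9`**: `c_1, …, c_9 = 4, 12, 36, 100, 284, 780, 2172, 5916, 16268`.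
[cite: MadrasSlade1993, Appendix C Table C.1 (d = 2), p. 394] -/
theorem count_two_le_nine :
    count 2 1 = 4 ∧ count 2 2 = 12 ∧ count 2 3 = 36 ∧ count 2 4 = 100 ∧ count 2 5 = 284 ∧ count 2 6 = 780 ∧
    count 2 7 = 2172 ∧ count 2 8 = 5916 ∧ count 2 9 = 16268 := by
  obtain ⟨h1, h2, h3, h4, h5, h6, h7, h8⟩ := Census2.length_walksRev_le_nine
  simp only [Census2.count_two_eq_length_walksRev]
  exact ⟨h1, h2, h3, h4, h5, h6, h7, h8, Census2.length_walksRev_nine⟩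

/-- **`q_N(ℤ²)` for `N ≤ 14`**: `q_4, q_6, …, q_14 = 1, 2, 7, 28, 124, 588`.
[cite: MadrasSlade1993, Appendix C Table C.3 (d = 2), p. 396, and Definition 3.2.2] -/
theorem polygonNumber_two_le_fourteen :
    PolygonConcat.polygonNumber 2 4 = 1 ∧ PolygonConcat.polygonNumber 2 6 = 2 ∧ PolygonConcat.polygonNumber 2 8 = 7 ∧
    PolygonConcat.polygonNumber 2 10 = 28 ∧ PolygonConcat.polygonNumber 2 12 = 124 ∧ PolygonConcat.polygonNumber 2 14 = 588 := by
  obtain ⟨h4, h6, h8, h10, h12⟩ := Census2.length_loopsRev_le_twelve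
  have h14 := Census2.length_loopsRev_fourteen
  have e := fun N (hN : 3 ≤ N) => Census2.two_mul_polygonNumber_two_eq N hN
  have e4 := e 4 (by norm_num); have e6 := e 6 (by norm_num); have e8 := e 8 (by norm_num)
  have e10 := e 10 (by norm_num); have e12 := e 12 (by norm_num); have e14 := e 14 (by norm_num)
  omega

/-- `c_1(ℤ²) = 4 = 2d` and `c_2 = 12`, `c_3 = 36 = 4·3²` but `c_4 = 100 < 4·3³ = 108`: the first self-avoidance constraint beyond
immediate reversals bites at `n = 4`. [cite: MadrasSlade1993, §1.1 (p. 2: c_1 = 2d, c_2 = 2d(2d−1), …; Table 1.1)] -/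
theorem count_two_four_lt : count 2 4 < 4 * 3 ^ 3 := by
  rw [count_two_le_nine.2.2.2.1]; norm_num

end Zd

end Literature.Probability.RandomPlanarGeometry.SAW
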